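import Mathlib

/-!
# A₅ certificates for the fusion-number-one calibration discs

Solo residency `solo-SmoothPoincare4-informed`, session 5 (evidence brick for the sub-rung
"GNS Question 5.4", cf. `FusionOne.matchable_iff_alexCoeff_nonneg`).

A fusion-number-one ribbon disc `A(w) ⊂ B⁴` with band word `w ∈ F(x₁, x₂)` has disc group
`Γ_A(w) = ⟨x₁, x₂ | x₁ = w x₂ w⁻¹⟩`.  For the two length-5 words
`w₁ = x₂ x₁ x₂⁻¹ x₂⁻¹ x₁` and `w₀ = x₂⁻¹ x₁⁻¹ x₂ x₂ x₁⁻¹` — the shortest band words whose disc has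
Alexander polynomial a unit while the disc is knotted — we certify by kernel computation in
`Equiv.Perm (Fin 5)`:

* the assignment `x₁ ↦ (2 3 4)`, `x₂ ↦ (0 1 2)` satisfies the disc relation for both words, so it
  defines homomorphisms `Γ_A(w₁) → Perm (Fin 5)`, `Γ_A(w₀) → Perm (Fin 5)` (via `PresentedGroup.toGroup`);
* the images do not commute, hence `Γ_A(w₁)`, `Γ_A(w₀)` are non-abelian (in particular not infinite
  cyclic: the discs, and their boundary knots, are non-trivial);
* the prefix classes `x₂² x₁⁻¹ x₂⁻¹`, `x₂ x₁⁻¹ x₂² x₁⁻¹ x₂⁻¹` (for `w₁`) and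
  `x₂⁻² x₁ x₂`, `x₂⁻¹ x₁ x₂⁻² x₁ x₂` (for `w₀`) — the classes of the Whitney circles of the two
  Gluck-unlinked pairs of the standard 2-minimum structure — map to non-identity permutations, so
  they are non-trivial in the disc group.

Everything is decided by `decide` on permutations of a 5-element type.
-/

namespace Summit.SmoothPoincare4.SmoothPoincare4.Theorems
namespace FusionOne

open Equiv

/-- Image of the generator `x₁`: the 3-cycle `(2 3 4)` of `Fin 5`. -/
def permX1 : Perm (Fin 5) := swap 2 4 * swap 2 3

/-- Image of the generator `x₂`: the 3-cycle `(0 1 2)` of `Fin 5`. -/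
def permX2 : Perm (Fin 5) := swap 0 2 * swap 0 1

/-- The band word `w₁ = x₂ x₁ x₂⁻¹ x₂⁻¹ x₁` evaluated on the images. -/
def permW1 : Perm (Fin 5) := permX2 * permX1 * permX2⁻¹ * permX2⁻¹ * permX1

/-- The band word `w₀ = x₂⁻¹ x₁⁻¹ x₂ x₂ x₁⁻¹` evaluated on the images. -/
def permW0 : Perm (Fin 5) := permX2⁻¹ * permX1⁻¹ * permX2 * permX2 * permX1⁻¹

/-- The disc relation `x₁ = w₁ x₂ w₁⁻¹` holds for the images. -/
theorem permX1_eq_conj_permW1 : permX1 = permW1 * permX2 * permW1⁻¹ := by decide +kernel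

/-- The disc relation `x₁ = w₀ x₂ w₀⁻¹` holds for the images. -/
theorem permX1_eq_conj_permW0 : permX1 = permW0 * permX2 * permW0⁻¹ := by decide +kernel

/-- The images of the generators do not commute. -/
theorem permX1_mul_permX2_ne : permX1 * permX2 ≠ permX2 * permX1 := by decide

/-- Prefix class of the pair `(e, in₅)` for `w₁`: `x₂ x₂ x₁⁻¹ x₂⁻¹ ↦` a non-identity permutation. -/
theorem prefixW1_a_ne_one : permX2 * permX2 * permX1⁻¹ * permX2⁻¹ ≠ 1 := by decide

/-- Prefix class of the pair `(in₂, out₅)` for `w₁`: `x₂ x₁⁻¹ x₂ x₂ x₁⁻¹ x₂⁻¹ ↦` a non-identity permutation. -/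
theorem prefixW1_b_ne_one :
    permX2 * permX1⁻¹ * permX2 * permX2 * permX1⁻¹ * permX2⁻¹ ≠ 1 := by decide

/-- Prefix class of the pair `(e, in₅)` for `w₀`: `x₂⁻¹ x₂⁻¹ x₁ x₂ ↦` a non-identity permutation. -/
theorem prefixW0_a_ne_one : permX2⁻¹ * permX2⁻¹ * permX1 * permX2 ≠ 1 := by decide

/-- Prefix class of the pair `(in₂, out₅)` for `w₀`: `x₂⁻¹ x₁ x₂⁻¹ x₂⁻¹ x₁ x₂ ↦` a non-identity permutation. -/
theorem prefixW0_b_ne_one :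
    permX2⁻¹ * permX1 * permX2⁻¹ * permX2⁻¹ * permX1 * permX2 ≠ 1 := by decide

/-! ### The presented disc groups -/

/-- The generator assignment `0 ↦ permX1`, `1 ↦ permX2`. -/
def permGen : Fin 2 → Perm (Fin 5) := fun i => if i = 0 then permX1 else permX2

/-- The band word `w₁` in the free group on `x₁ = of 0`, `x₂ = of 1`. -/
def freeW1 : FreeGroup (Fin 2) :=
  FreeGroup.of 1 * FreeGroup.of 0 * (FreeGroup.of 1)⁻¹ * (FreeGroup.of 1)⁻¹ * FreeGroup.of 0

/-- The band word `w₀` in the free group on `x₁ = of 0`, `x₂ = of 1`. -/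
def freeW0 : FreeGroup (Fin 2) :=
  (FreeGroup.of 1)⁻¹ * (FreeGroup.of 0)⁻¹ * FreeGroup.of 1 * FreeGroup.of 1 * (FreeGroup.of 0)⁻¹

/-- The disc relator `x₁⁻¹ · w x₂ w⁻¹` of a fusion-number-one ribbon disc with band word `w`. -/
def discRelator (w : FreeGroup (Fin 2)) : FreeGroup (Fin 2) :=
  (FreeGroup.of 0)⁻¹ * (w * FreeGroup.of 1 * w⁻¹)

/-- The disc group `⟨x₁, x₂ | x₁ = w x₂ w⁻¹⟩`. -/
abbrev DiscGroup (w : FreeGroup (Fin 2)) : Type := PresentedGroup ({discRelator w} : Set (FreeGroup (Fin 2)))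

/-- `FreeGroup.lift permGen` evaluates the word `w₁` to `permW1`. -/
theorem lift_permGen_freeW1 : FreeGroup.lift permGen freeW1 = permW1 := by
  simp [freeW1, permW1, permGen, map_mul, map_inv]

/-- `FreeGroup.lift permGen` evaluates the word `w₀` to `permW0`. -/
theorem lift_permGen_freeW0 : FreeGroup.lift permGen freeW0 = permW0 := by
  simp [freeW0, permW0, permGen, map_mul, map_inv]

/-- `FreeGroup.lift permGen` sends `x₁ = of 0` to `permX1`. -/
theorem lift_permGen_of_zero : FreeGroup.lift permGen (FreeGroup.of (0 : Fin 2)) = permX1 := by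
  simp [permGen]

/-- `FreeGroup.lift permGen` sends `x₂ = of 1` to `permX2`. -/
theorem lift_permGen_of_one : FreeGroup.lift permGen (FreeGroup.of (1 : Fin 2)) = permX2 := by
  simp [permGen]

/-- The disc relator of `w₁` dies under `FreeGroup.lift permGen`. -/
theorem lift_permGen_discRelator_freeW1 : FreeGroup.lift permGen (discRelator freeW1) = 1 := by
  rw [discRelator, map_mul, map_mul, map_mul, map_inv, map_inv, lift_permGen_freeW1,
    lift_permGen_of_zero, lift_permGen_of_one, ← permX1_eq_conj_permW1, inv_mul_cancel]

/-- The disc relator of `w₀` dies under `FreeGroup.lift permGen`. -/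
theorem lift_permGen_discRelator_freeW0 : FreeGroup.lift permGen (discRelator freeW0) = 1 := by
  rw [discRelator, map_mul, map_mul, map_mul, map_inv, map_inv, lift_permGen_freeW0,
    lift_permGen_of_zero, lift_permGen_of_one, ← permX1_eq_conj_permW0, inv_mul_cancel]

/-- The representation `Γ_A(w₁) → Perm (Fin 5)`. -/
def discRepW1 : DiscGroup freeW1 →* Perm (Fin 5) :=
  PresentedGroup.toGroup (f := permGen) (by
    intro r hr
    rw [Set.mem_singleton_iff] at hr
    subst hr
    exact lift_permGen_discRelator_freeW1)

/-- The representation `Γ_A(w₀) → Perm (Fin 5)`. -/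
def discRepW0 : DiscGroup freeW0 →* Perm (Fin 5) :=
  PresentedGroup.toGroup (f := permGen) (by
    intro r hr
    rw [Set.mem_singleton_iff] at hr
    subst hr
    exact lift_permGen_discRelator_freeW0)

/-- The disc group of `w₁` is non-abelian: its generators do not commute. -/
theorem discGroup_freeW1_of_noncomm :
    (PresentedGroup.of 0 : DiscGroup freeW1) * PresentedGroup.of 1 ≠
      PresentedGroup.of 1 * PresentedGroup.of 0 := by
  intro h
  have h' := congrArg discRepW1 h
  simp only [map_mul, discRepW1, PresentedGroup.toGroup.of, permGen] at h'
  simp only [Fin.isValue, ↓reduceIte, one_ne_zero] at h'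
  exact permX1_mul_permX2_ne h'

/-- The disc group of `w₀` is non-abelian: its generators do not commute. -/
theorem discGroup_freeW0_of_noncomm :
    (PresentedGroup.of 0 : DiscGroup freeW0) * PresentedGroup.of 1 ≠
      PresentedGroup.of 1 * PresentedGroup.of 0 := by
  intro h
  have h' := congrArg discRepW0 h
  simp only [map_mul, discRepW0, PresentedGroup.toGroup.of, permGen] at h'
  simp only [Fin.isValue, ↓reduceIte, one_ne_zero] at h'
  exact permX1_mul_permX2_ne h'

/-- In the disc group of `w₁`, the prefix class `x₂ x₂ x₁⁻¹ x₂⁻¹` of the Gluck-unlinked pair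
`(e, in₅)` is non-trivial. -/
theorem discGroup_freeW1_prefix_a_ne_one :
    (PresentedGroup.of 1 : DiscGroup freeW1) * PresentedGroup.of 1 * (PresentedGroup.of 0)⁻¹ *
      (PresentedGroup.of 1)⁻¹ ≠ 1 := by
  intro h
  have h' := congrArg discRepW1 h
  simp only [map_mul, map_inv, map_one, discRepW1, PresentedGroup.toGroup.of, permGen] at h'
  simp only [Fin.isValue, ↓reduceIte, one_ne_zero] at h'
  exact prefixW1_a_ne_one h'

/-- In the disc group of `w₁`, the prefix class `x₂ x₁⁻¹ x₂ x₂ x₁⁻¹ x₂⁻¹` of the Gluck-unlinked pair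
`(in₂, out₅)` is non-trivial. -/
theorem discGroup_freeW1_prefix_b_ne_one :
    (PresentedGroup.of 1 : DiscGroup freeW1) * (PresentedGroup.of 0)⁻¹ * PresentedGroup.of 1 *
      PresentedGroup.of 1 * (PresentedGroup.of 0)⁻¹ * (PresentedGroup.of 1)⁻¹ ≠ 1 := by
  intro h
  have h' := congrArg discRepW1 h
  simp only [map_mul, map_inv, map_one, discRepW1, PresentedGroup.toGroup.of, permGen] at h'
  simp only [Fin.isValue, ↓reduceIte, one_ne_zero] at h'
  exact prefixW1_b_ne_one h'

/-- In the disc group of `w₀`, the prefix class `x₂⁻¹ x₂⁻¹ x₁ x₂` of the pair `(e, in₅)` is non-trivial. -/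
theorem discGroup_freeW0_prefix_a_ne_one :
    (PresentedGroup.of 1 : DiscGroup freeW0)⁻¹ * (PresentedGroup.of 1)⁻¹ * PresentedGroup.of 0 *
      PresentedGroup.of 1 ≠ 1 := by
  intro h
  have h' := congrArg discRepW0 h
  simp only [map_mul, map_inv, map_one, discRepW0, PresentedGroup.toGroup.of, permGen] at h'
  simp only [Fin.isValue, ↓reduceIte, one_ne_zero] at h'
  exact prefixW0_a_ne_one h'

/-- In the disc group of `w₀`, the prefix class `x₂⁻¹ x₁ x₂⁻¹ x₂⁻¹ x₁ x₂` of the pair `(in₂, out₅)` is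
non-trivial. -/
theorem discGroup_freeW0_prefix_b_ne_one :
    (PresentedGroup.of 1 : DiscGroup freeW0)⁻¹ * PresentedGroup.of 0 * (PresentedGroup.of 1)⁻¹ *
      (PresentedGroup.of 1)⁻¹ * PresentedGroup.of 0 * PresentedGroup.of 1 ≠ 1 := by
  intro h
  have h' := congrArg discRepW0 h
  simp only [map_mul, map_inv, map_one, discRepW0, PresentedGroup.toGroup.of, permGen] at h'
  simp only [Fin.isValue, ↓reduceIte, one_ne_zero] at h'
  exact prefixW0_b_ne_one h'

end FusionOne
end Summit.SmoothPoincare4.SmoothPoincare4.Theorems
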